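import Summits.MatrixMultiplication.MatrixMultiplication.Theorems.ObstructionCalculusAction

/-!
# ObstructionDescent — the obstruction calculus, PART 2 of 5: `ObstructionCalculusInvariants`

LANDING SPLIT (decomp-mm-lander-1 g1, 2026-08-30; mechanical, for the 400-line lint; REQUESTS #16-ii, decomp-mm SUMMON
Tier 3 (10)) of «Part 1 + Part 1b — the obstruction calculus on cubic tensor formats» of the lens-3 gen-8 kernel
`DegreeFiltration_g8_tree.lean` (sha256 `132d565c…aec8`, 2383 lines; critic-CLEARED decomp-mm STATUS l.348/365; rc0, the
calculus parts sorry-free).  This file = «Invariants»: types, weight vectors, orbit-vanishing ideals, the density argument `GL_m³·⟨m⟩ → Mat_m³·⟨m⟩` (source lines 348–577),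
copied byte-identically inside the source namespace `Summit.MatrixMultiplication.MatrixMultiplication.Theorems.ObstructionCalculus`
with the source header (`noncomputable section`, opens).  Route-free: imports Literature / the previous part only, NO `Theses`
file (lint `theses-cone`).  The five parts Action → Invariants → Slots → PadInheritance → Locality form one import chain and
SUPPORT the crux `NoOccurrenceObstruction` (item `stmt-MatrixMultiplication-29040`, route-MatrixMultiplication-ObstructionDescent)
WITHOUT closing anything; nothing here proves ω = 2.  Full mathematical commentary: the module docstring of the source kernel
(HOME/decomp-mm-lens-3/pkg-ObstructionDescent-g8/) and the docstrings below.
-/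

set_option linter.dupNamespace false
set_option autoImplicit false

noncomputable section

open scoped BigOperators
open Filter Asymptotics Finset

namespace Summit.MatrixMultiplication.MatrixMultiplication.Theorems

namespace ObstructionCalculus

open Literature.Computability.AlgebraicComplexity (triad triad_apply tensorRank matMulTensor unitTensor
  unitTensor_apply exists_eq_sum_triad_of_tensorRank_le actTensor actTensor_apply actTensor_zero actTensor_triad)

section Invariants

variable {m : ℕ}

/-- Evaluation of a polynomial function on the tensor space `ℂ^m ⊗ ℂ^m ⊗ ℂ^m` at the tensor `t`. [bookkeeping] -/
def evalT (t : Tensor ℂ m) : MvPolynomial (Idx m) ℂ →ₐ[ℂ] ℂ :=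
  MvPolynomial.aeval fun p : Idx m => t p.1 p.2.1 p.2.2

/-- The polynomials vanishing on the orbit `GL_m³ · t` (equivalently — Zariski = Euclidean closure of
orbits — on the orbit closure): a linear subspace (indeed an ideal) of `ℂ[ℂ^m ⊗ ℂ^m ⊗ ℂ^m]`.
[cite: BurgisserIkenmeyer2011, §3.1] -/
def orbitVanishing (t : Tensor ℂ m) : Submodule ℂ (MvPolynomial (Idx m) ℂ) where
  carrier := {f | ∀ A B C : Matrix (Fin m) (Fin m) ℂ, A.det ≠ 0 → B.det ≠ 0 → C.det ≠ 0 →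
    evalT (actTensor A B C t) f = 0}
  zero_mem' := fun A B C _ _ _ => map_zero _
  add_mem' := by
    intro f g hf hg A B C hA hB hC
    rw [map_add, hf A B C hA hB hC, hg A B C hA hB hC, add_zero]
  smul_mem' := by
    intro r f hf A B C hA hB hC
    rw [map_smul, hf A B C hA hB hC, smul_zero]

/-- Membership in `orbitVanishing t`. [bookkeeping] -/
theorem mem_orbitVanishing {t : Tensor ℂ m} {f : MvPolynomial (Idx m) ℂ} :
    f ∈ orbitVanishing t ↔ ∀ A B C : Matrix (Fin m) (Fin m) ℂ, A.det ≠ 0 → B.det ≠ 0 → C.det ≠ 0 →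
      evalT (actTensor A B C t) f = 0 := Iff.rfl

variable (m) in
/-- The standard Borel subgroup `B_m ≤ GL_m(ℂ)`: upper-triangular matrices with non-zero diagonal. [bookkeeping] -/
def borel : Set (Matrix (Fin m) (Fin m) ℂ) :=
  {A | (∀ i j : Fin m, j < i → A i j = 0) ∧ ∀ i : Fin m, A i i ≠ 0}

/-- The character `b ↦ Π_i b_{ii}^{λ_i}` of `B_m` with exponent vector `λ ∈ ℕ^m`. [bookkeeping] -/
def weightChar (lam : Fin m → ℕ) (A : Matrix (Fin m) (Fin m) ℂ) : ℂ :=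
  ∏ i, A i i ^ lam i

/-- The space of WEIGHT VECTORS OF TYPE `Λ = (λ⁽¹⁾,λ⁽²⁾,λ⁽³⁾)` IN DEGREE `d`: homogeneous degree-`d`
polynomial functions `f` on `ℂ^m ⊗ ℂ^m ⊗ ℂ^m` that are `B_m³`-eigenvectors under substitution,
`f((A,B,C)·t) = Λ(A,B,C)·f(t)` for all upper-triangular invertible `A, B, C`, with eigencharacter
`weightChar λ⁽¹⁾ ⊗ weightChar λ⁽²⁾ ⊗ weightChar λ⁽³⁾` (together with `0`).  Under the contragredient
relabelling this is the space of highest weight vectors of ONE irreducible `GL_m³`-type in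
`ℂ[ℂ^m ⊗ ℂ^m ⊗ ℂ^m]_d`; the relabelling is a fixed bijection on labels and every statement below
quantifies over ALL labels `Λ`, so it is immaterial. [cite: BurgisserIkenmeyer2011, §3.1–3.2] -/
def hwvSpace (Λ : Fin 3 → Fin m → ℕ) (d : ℕ) : Submodule ℂ (MvPolynomial (Idx m) ℂ) where
  carrier := {f | f.IsHomogeneous d ∧ ∀ A B C : Matrix (Fin m) (Fin m) ℂ, A ∈ borel m → B ∈ borel m →
    C ∈ borel m → ∀ t : Tensor ℂ m, evalT (actTensor A B C t) f =
      weightChar (Λ 0) A * weightChar (Λ 1) B * weightChar (Λ 2) C * evalT t f}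
  zero_mem' := ⟨MvPolynomial.isHomogeneous_zero _ _ _, fun _ _ _ _ _ _ _ => by simp⟩
  add_mem' := by
    rintro f g ⟨hf, hf'⟩ ⟨hg, hg'⟩
    refine ⟨hf.add hg, fun A B C hA hB hC t => ?_⟩
    rw [map_add, map_add, hf' A B C hA hB hC t, hg' A B C hA hB hC t]
    ring
  smul_mem' := by
    rintro r f ⟨hf, hf'⟩
    refine ⟨?_, fun A B C hA hB hC t => ?_⟩
    · rw [MvPolynomial.smul_eq_C_mul]
      exact hf.C_mul r
    · rw [map_smul, map_smul, hf' A B C hA hB hC t, smul_eq_mul, smul_eq_mul]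
      ring

/-- Weight vectors of degree `d` have total degree `≤ d`. [bookkeeping] -/
theorem hwvSpace_le_restrictTotalDegree (Λ : Fin 3 → Fin m → ℕ) (d : ℕ) :
    hwvSpace Λ d ≤ MvPolynomial.restrictTotalDegree (Idx m) ℂ d :=
  fun _ hf => (MvPolynomial.mem_restrictTotalDegree _ _ _).2 hf.1.totalDegree_le

/-- Each `hwvSpace Λ d` is finite-dimensional. [bookkeeping] -/
theorem finite_hwvSpace (Λ : Fin 3 → Fin m → ℕ) (d : ℕ) : Module.Finite ℂ (hwvSpace Λ d) :=
  Submodule.finiteDimensional_of_le (hwvSpace_le_restrictTotalDegree Λ d)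

/-! **Occurrence.** The type `Λ` OCCURS in degree `d` in the coordinate ring of the orbit closure of `t`
iff some weight vector of type `Λ` and degree `d` does not vanish on `GL_m³·t`, i.e. iff
`¬ (hwvSpace Λ d ≤ orbitVanishing t)` (Bürgisser–Ikenmeyer 2011, §3.1: `λ ∈ S(t)`); an OCCURRENCE
OBSTRUCTION against `s ∈ closure(GL_m³·t)` is a type occurring for `s` but not for `t`.  We use the order
relation `hwvSpace Λ d ≤ orbitVanishing ·` directly and introduce no predicate. -/

/-- **Co-multiplicity** `coMult t Λ d = dim (HWV_{Λ,d} ∩ I(GL_m³·t))`: the number of independent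
weight vectors of type `Λ`, degree `d`, vanishing on the orbit closure of `t`; the MULTIPLICITY of the
type in `ℂ[closure(GL_m³·t)]_d` is `dim HWV_{Λ,d} − coMult t Λ d`, so "multiplicity in `t` ≤
multiplicity in `s`" reads `coMult s Λ d ≤ coMult t Λ d`. [cite: BurgisserIkenmeyer2011, §3.1] -/
def coMult (t : Tensor ℂ m) (Λ : Fin 3 → Fin m → ℕ) (d : ℕ) : ℕ :=
  Module.finrank ℂ ↥(hwvSpace Λ d ⊓ orbitVanishing t)

/-! ### The density argument: a polynomial vanishing on `GL_m³·⟨m⟩` vanishes on `Mat_m³·⟨m⟩` -/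

/-- Variables for the entries of a triple of `m × m` matrices. [bookkeeping] -/
abbrev MIdx (m : ℕ) : Type := Fin 3 × Fin m × Fin m

/-- The three generic matrices. [bookkeeping] -/
def genMat (s : Fin 3) : Matrix (Fin m) (Fin m) (MvPolynomial (MIdx m) ℂ) :=
  fun i l => MvPolynomial.X (s, i, l)

/-- The matrices encoded by an assignment of the matrix-entry variables. [bookkeeping] -/
def matOf (e : MIdx m → ℂ) (s : Fin 3) : Matrix (Fin m) (Fin m) ℂ :=
  fun i l => e (s, i, l)

/-- Evaluating the generic `[A|B|C]` at an assignment gives `[A|B|C]` of the assigned matrices. [bookkeeping] -/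
theorem aeval_fromCols_genMat (e : MIdx m → ℂ) (a b c : Fin m) :
    MvPolynomial.aeval e (fromCols (genMat 0) (genMat 1) (genMat 2) a b c) =
      fromCols (matOf e 0) (matOf e 1) (matOf e 2) a b c := by
  simp [fromCols, Finset.sum_apply, triad_apply, genMat, matOf, map_sum, map_mul]

/-- Evaluating a generic determinant at an assignment gives the determinant of the assigned matrix. [bookkeeping] -/
theorem aeval_det_genMat (e : MIdx m → ℂ) (s : Fin 3) :
    MvPolynomial.aeval e (genMat (m := m) s).det = (matOf e s).det := by
  rw [AlgHom.map_det]
  congr 1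
  ext i l
  simp [genMat, matOf, AlgHom.mapMatrix_apply]

/-- Every assignment of matrices arises from an assignment of the variables. [bookkeeping] -/
theorem matOf_entries (A B C : Matrix (Fin m) (Fin m) ℂ) :
    ∃ e : MIdx m → ℂ, matOf e 0 = A ∧ matOf e 1 = B ∧ matOf e 2 = C := by
  refine ⟨fun q => ![A, B, C] q.1 q.2.1 q.2.2, ?_, ?_, ?_⟩ <;> ext i l <;> simp [matOf]

/-- **Density of `GL_m³·⟨m⟩` in `Mat_m³·⟨m⟩` (polynomial form).** A polynomial vanishing at `[A|B|C]`
for all INVERTIBLE `A, B, C` vanishes at `[A|B|C]` for ALL `A, B, C`: the pull-back `P(A,B,C) =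
f([A|B|C])` satisfies `P · det A · det B · det C ≡ 0` as a function, hence as a polynomial
(`MvPolynomial.funext`, `ℂ` infinite), and `det A · det B · det C ≠ 0` in the domain `ℂ[A,B,C]`.
[cite: BurgisserIkenmeyer2011, §3.1 (orbit closures; Zariski closure of the orbit)] -/
theorem evalT_fromCols_eq_zero_of_generic (f : MvPolynomial (Idx m) ℂ)
    (h : ∀ A B C : Matrix (Fin m) (Fin m) ℂ, A.det ≠ 0 → B.det ≠ 0 → C.det ≠ 0 →
      evalT (fromCols A B C) f = 0)
    (A B C : Matrix (Fin m) (Fin m) ℂ) : evalT (fromCols A B C) f = 0 := by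
  classical
  set Q : Idx m → MvPolynomial (MIdx m) ℂ :=
    fun p => fromCols (genMat 0) (genMat 1) (genMat 2) p.1 p.2.1 p.2.2 with hQ
  set P : MvPolynomial (MIdx m) ℂ := MvPolynomial.bind₁ Q f with hPdef
  set D : MvPolynomial (MIdx m) ℂ :=
    (genMat (m := m) 0).det * (genMat (m := m) 1).det * (genMat (m := m) 2).det with hD
  -- evaluating `P` at an assignment is evaluating `f` at `[A|B|C]` of the assigned matrices
  have hP : ∀ e : MIdx m → ℂ,
      MvPolynomial.aeval e P = evalT (fromCols (matOf e 0) (matOf e 1) (matOf e 2)) f := by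
    intro e
    have hfun : (fun p : Idx m => MvPolynomial.aeval e (Q p)) =
        fun p : Idx m => fromCols (matOf e 0) (matOf e 1) (matOf e 2) p.1 p.2.1 p.2.2 :=
      funext fun p => aeval_fromCols_genMat e p.1 p.2.1 p.2.2
    rw [hPdef, MvPolynomial.aeval_bind₁, hfun]
    rfl
  have hDe : ∀ e : MIdx m → ℂ,
      MvPolynomial.aeval e D = (matOf e 0).det * (matOf e 1).det * (matOf e 2).det := by
    intro e
    rw [hD, map_mul, map_mul, aeval_det_genMat, aeval_det_genMat, aeval_det_genMat]
  -- `P * D` vanishes everywhere, hence is the zero polynomial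
  have hPD : P * D = 0 := by
    apply MvPolynomial.funext
    intro e
    rw [map_zero, map_mul]
    change MvPolynomial.aeval e P * MvPolynomial.aeval e D = 0
    by_cases hdet : MvPolynomial.aeval e D = 0
    · rw [hdet, mul_zero]
    · rw [hDe] at hdet
      have hA : (matOf e 0).det ≠ 0 := fun h0 => hdet (by rw [h0, zero_mul, zero_mul])
      have hB : (matOf e 1).det ≠ 0 := fun h0 => hdet (by rw [h0, mul_zero, zero_mul])
      have hC : (matOf e 2).det ≠ 0 := fun h0 => hdet (by rw [h0, mul_zero])
      rw [hP, h _ _ _ hA hB hC, zero_mul]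
  -- `D ≠ 0`: it evaluates to `1` at the identity matrices
  have hD0 : D ≠ 0 := by
    intro hD0
    obtain ⟨e, he0, he1, he2⟩ := matOf_entries (m := m) 1 1 1
    have := hDe e
    rw [hD0, map_zero, he0, he1, he2, Matrix.det_one, mul_one, mul_one] at this
    exact zero_ne_one this
  have hP0 : P = 0 := (mul_eq_zero.1 hPD).resolve_right hD0
  obtain ⟨e, he0, he1, he2⟩ := matOf_entries A B C
  have := hP e
  rw [hP0, map_zero, he0, he1, he2] at this
  exact this.symm

/-- **Monotonicity of orbit-closure ideals under degeneration to rank `≤ m`.** If `s = [A₀|B₀|C₀] ∈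
Mat_m³·⟨m⟩` (e.g. `s = pad_m⟨n,n,n⟩` with `R(⟨n,n,n⟩) ≤ m`), every polynomial vanishing on `GL_m³·⟨m⟩`
vanishes on `GL_m³·s`, i.e. `closure(GL_m³·s) ⊆ closure(GL_m³·⟨m⟩)` on the level of ideals.
[cite: BurgisserIkenmeyer2011, §3.1 and Prop. 3.3] -/
theorem orbitVanishing_unitTensor_le {s : Tensor ℂ m} {A₀ B₀ C₀ : Matrix (Fin m) (Fin m) ℂ}
    (hs : s = fromCols A₀ B₀ C₀) : orbitVanishing (unitTensor ℂ m) ≤ orbitVanishing s := by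
  intro f hf A B C _ _ _
  rw [hs, actTensor_fromCols]
  apply evalT_fromCols_eq_zero_of_generic f
  intro A' B' C' hA' hB' hC'
  have h' := hf A' B' C' hA' hB' hC'
  rwa [actTensor_unitTensor] at h'

/-- **Occurrence obstructions are sound** (necessity): if `s ∈ Mat_m³·⟨m⟩` then every type NOT occurring
for `⟨m⟩` does not occur for `s` — `S(s) ⊆ S(⟨m⟩)` (Bürgisser–Ikenmeyer 2011, Prop. 3.3).
[cite: BurgisserIkenmeyer2011, Prop. 3.3] -/
theorem hwvSpace_le_orbitVanishing_of_fromCols {s : Tensor ℂ m} {A₀ B₀ C₀ : Matrix (Fin m) (Fin m) ℂ}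
    (hs : s = fromCols A₀ B₀ C₀) {Λ : Fin 3 → Fin m → ℕ} {d : ℕ}
    (h : hwvSpace Λ d ≤ orbitVanishing (unitTensor ℂ m)) : hwvSpace Λ d ≤ orbitVanishing s :=
  h.trans (orbitVanishing_unitTensor_le hs)

/-- **Multiplicity obstructions are sound** (necessity): if `s ∈ Mat_m³·⟨m⟩` then, type by type and
degree by degree, `mult_Λ ℂ[closure(GL³ s)]_d ≤ mult_Λ ℂ[closure(GL³ ⟨m⟩)]_d`, i.e.
`coMult ⟨m⟩ Λ d ≤ coMult s Λ d` (surjection of coordinate rings + Schur's lemma; here: inclusion of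
the vanishing subspaces). [cite: BurgisserIkenmeyer2011, §3.1] -/
theorem coMult_unitTensor_le {s : Tensor ℂ m} {A₀ B₀ C₀ : Matrix (Fin m) (Fin m) ℂ}
    (hs : s = fromCols A₀ B₀ C₀) (Λ : Fin 3 → Fin m → ℕ) (d : ℕ) :
    coMult (unitTensor ℂ m) Λ d ≤ coMult s Λ d := by
  haveI := finite_hwvSpace (m := m) Λ d
  haveI : Module.Finite ℂ ↥(hwvSpace Λ d ⊓ orbitVanishing s) :=
    Submodule.finiteDimensional_of_le inf_le_left
  exact Submodule.finrank_mono (inf_le_inf_left _ (orbitVanishing_unitTensor_le hs))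

/-- **Multiplicity domination implies occurrence inclusion** (for any two tensors of the same format):
if `coMult u Λ d ≤ coMult s Λ d` and `Λ` does not occur for `u` in degree `d`, then it does not occur for
`s` (dimension count in the finite-dimensional space `HWV_{Λ,d}`). [bookkeeping] -/
theorem hwvSpace_le_orbitVanishing_of_coMult_le {s u : Tensor ℂ m} {Λ : Fin 3 → Fin m → ℕ} {d : ℕ}
    (hle : coMult u Λ d ≤ coMult s Λ d) (hu : hwvSpace Λ d ≤ orbitVanishing u) :
    hwvSpace Λ d ≤ orbitVanishing s := by
  by_contra hno
  obtain ⟨f, hf, hfs⟩ := SetLike.not_le_iff_exists.1 hno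
  haveI := finite_hwvSpace (m := m) Λ d
  haveI : Module.Finite ℂ ↥(hwvSpace Λ d ⊓ orbitVanishing u) :=
    Submodule.finiteDimensional_of_le inf_le_left
  have h1 : Module.finrank ℂ ↥(hwvSpace Λ d) ≤ coMult u Λ d :=
    Submodule.finrank_mono (le_inf le_rfl hu)
  have hlt : hwvSpace Λ d ⊓ orbitVanishing s < hwvSpace Λ d := by
    refine lt_of_le_of_ne inf_le_left fun heq => hfs ?_
    have hf' : f ∈ hwvSpace Λ d ⊓ orbitVanishing s := by rw [heq]; exact hf
    exact hf'.2
  have h2 : coMult s Λ d < Module.finrank ℂ ↥(hwvSpace Λ d) := Submodule.finrank_lt_finrank_of_lt hlt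
  omega

/-- The co-multiplicity as the dimension of a span (the form used by the inlined route item `P_M`). [bookkeeping] -/
theorem finrank_span_inter_eq_coMult (t : Tensor ℂ m) (Λ : Fin 3 → Fin m → ℕ) (d : ℕ) :
    Module.finrank ℂ ↥(Submodule.span ℂ ((hwvSpace Λ d : Set (MvPolynomial (Idx m) ℂ)) ∩
      (orbitVanishing t : Set (MvPolynomial (Idx m) ℂ)))) = coMult t Λ d := by
  unfold coMult
  rw [← Submodule.coe_inf, Submodule.span_eq]

end Invariants

end ObstructionCalculus

end Summit.MatrixMultiplication.MatrixMultiplication.Theorems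

end
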